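import Summits.BirchSwinnertonDyer.BirchSwinnertonDyer.Theorems.ByReductionTypeAtTwoTowerLayerDuality
import HarnessLib

/-!
# Both TOWER certificates at the level of the RELAXED layer Selmer group `A_j = h_j⁻¹(Sel_∞)`:
# `2^n ≤ #A_j[2]` ⇒ `hrank`, and `#A_{j'}[2] < 2^{2^{j'} − 2^j} · #A_j[2]` ⇒ `O1.TowerGapAtTwo W` — EXACT
# readings, no local error term (route ByReductionTypeAtTwo, crux `OrdKatoHalfAtTwo`, item
# stmt-BirchSwinnertonDyer-19271; seat bsd-2adic-tower-1, D-0074 (T1), part 2b)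

HONEST FRAMING (cell `bsd-2adic`, run/shared/lean/pub/bsd-2adic/, HUMAN RULINGS D-0036/D-0074): THEOREMS
ONLY; nothing asserted; no definition; no new named fact; closes nothing by itself.

Part 2 (`…TowerLayerDuality.lean`) PROVED `#X/(2, T^{2^j})X = #A_j[2]` for every cyclotomic datum of a
curve with `E(ℚ)[2] = 0`, where `A_j ⊆ H¹(ℚ_j, E[2^∞])` is the preimage of `Sel_{2^∞}(E/ℚ_∞)` under
restriction (`selmerInftyPreimage κ j`) — the `2^∞`-Selmer group of `E` over the layer `ℚ_j` with the
local conditions RELAXED to those induced from `ℚ_∞` (at `2`: Greenberg's `im λ_η`, Prop. 2.4; at a bad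
odd `v`: the kernel of `H¹(ℚ_{j,v}, E) → H¹(ℚ_{∞,η}, E)`). Hence BOTH inputs of the TOWER doors
(`Theorems/ByReductionTypeAtTwoTowerLambdaRank.lean`) are EXACTLY counts of `2`-torsion classes of
relaxed layer Selmer groups — no local error term, no slack:

* `towerRank_of_layerClasses`: `2^n ≤ #A_j[2]` (every cyclotomic `κ`) ⇒ `hrank`.
* `towerGapAtTwo_of_layerClasses_exact`: `#A_{j'}[2] < 2^{2^{j'} − 2^j} · #A_j[2]`, `j ≤ j'` ⇒
  `O1.TowerGapAtTwo W`.

WHY BOTH READINGS ARE KEPT (note for the engineer / planner, nothing asserted): the strict layer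
Selmer group satisfies only `#Sel_{2^∞}(E/ℚ_j)[2] ≤ #A_j[2] ≤ #Sel_{2^∞}(E/ℚ_j)[2] · ∏ (local kernels)`
(parts 1, 3a), and at `p = 2` the local kernel at the prime above `2` is NEVER trivial on a good
ordinary curve (Lemma 3.4: `|Ẽ(𝔽₂)_2|² ∈ {4, 16}`), so a certificate read off the STRICT Selmer group
may undershoot `λ` (rank side) or overshoot the gap (gap side) where the relaxed count would succeed; a
descent engine that evaluates the relaxed local conditions feeds these exact forms instead.

References: R. Greenberg, LNM 1716 (1999), §1 p. 60, §2 Prop. 2.4, §3 pp. 85–90; L. Washington,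
*Introduction to Cyclotomic Fields*, §13.2.
-/

set_option autoImplicit false

noncomputable section

open scoped Classical

open WeierstrassCurve Literature.NumberTheory.EllipticCurves
  Summit.BirchSwinnertonDyer.Rank1Residual Summit.BirchSwinnertonDyer.Rank1Residual.X5.O1
  Summit.BirchSwinnertonDyer.Rank1Residual.X5.TowerGap

namespace Summit.BirchSwinnertonDyer.BirchSwinnertonDyer.Theorems.KatoHalfPinch

section Curve

variable (W : WeierstrassCurve ℚ) [W.IsElliptic] [W.IsGloballyMinimal]

omit [W.IsGloballyMinimal] in
/-- **The RANK certificate, exact reading**: `2 ∤ #E(ℚ)_tors` and `2^n ≤ #A_j[2]` for every cyclotomic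
`κ` (`A_j = h_j⁻¹(Sel_{2^∞}(E/ℚ_∞)) ⊆ H¹(ℚ_j, E[2^∞])`) ⇒ for every cyclotomic datum
`2^n ≤ #X/(2, T^{2^j})X` — the hypothesis `hrank` of `le_lambda_of_towerGap_of_towerRank` and of the
doors `…_of_towerGap_of_towerRank`. [cite: GreenbergLNM1716, §1 p. 60 and §3 pp. 85–86] -/
theorem towerRank_of_layerClasses (htors : ¬ 2 ∣ W.torsionOrder) {j n : ℕ}
    (hA : ∀ κ : ZpExtension ℚ 2, κ.IsCyclotomic →
      2 ^ n ≤ Nat.card {z : W.selmerInftyPreimage κ j // 2 • z = 0}) :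
    ∀ (κ : ZpExtension ℚ 2) (γ : Field.absoluteGaloisGroup ℚ), κ.IsCyclotomic →
      κ.IsTopGenerator γ → IsCyclotomicVariable 2 γ → ∀ D : W.SelmerDualData κ γ,
      ∃ j' : ℕ, 2 ^ n ≤ Nat.card (D.X ⧸ (towerIdeal 2 j' • ⊤ : Submodule (IwasawaAlgebra 2) D.X)) := by
  intro κ γ hκ hγ _ D
  haveI : Module.Finite (IwasawaAlgebra 2) D.X := D.module_finite_holds hγ
  have hK := Iwasawa.forall_smul_eq_zero_imp_of_not_dvd_torsionOrder W htors
  exact ⟨2 ^ j, by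
    rw [TowerLayer.natCard_quotient_towerIdeal_eq_natCard_layerClasses W κ D hγ hK j]; exact hA κ hκ⟩

omit [W.IsGloballyMinimal] in
/-- **The GAP certificate, exact reading**: `2 ∤ #E(ℚ)_tors`, `j ≤ j'` and
`#A_{j'}[2] < 2^{2^{j'} − 2^j} · #A_j[2]` for every cyclotomic `κ` ⇒ `O1.TowerGapAtTwo W` (with
`m = 2^j`, `k = 2^{j'} − 2^j`; both sides are EXACTLY `#X/(2, T^{2^{j'}})X` and `2^k · #X/(2, T^{2^j})X`).
[cite: GreenbergLNM1716, §1 p. 60 and §3 pp. 85–86] [cite: Washington1997, §13.2] -/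
theorem towerGapAtTwo_of_layerClasses_exact (htors : ¬ 2 ∣ W.torsionOrder) {j j' : ℕ}
    (hjj' : j ≤ j')
    (hA : ∀ κ : ZpExtension ℚ 2, κ.IsCyclotomic →
      Nat.card {z : W.selmerInftyPreimage κ j' // 2 • z = 0} <
        2 ^ (2 ^ j' - 2 ^ j) * Nat.card {z : W.selmerInftyPreimage κ j // 2 • z = 0}) :
    TowerGapAtTwo W := by
  intro κ γ hκ hγ _ D
  haveI : Module.Finite (IwasawaAlgebra 2) D.X := D.module_finite_holds hγ
  have hK := Iwasawa.forall_smul_eq_zero_imp_of_not_dvd_torsionOrder W htors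
  refine ⟨2 ^ j, 2 ^ j' - 2 ^ j, ?_⟩
  rw [Nat.add_sub_cancel' (Nat.pow_le_pow_right (by norm_num) hjj'),
    TowerLayer.natCard_quotient_towerIdeal_eq_natCard_layerClasses W κ D hγ hK j',
    TowerLayer.natCard_quotient_towerIdeal_eq_natCard_layerClasses W κ D hγ hK j]
  exact hA κ hκ

end Curve

end Summit.BirchSwinnertonDyer.BirchSwinnertonDyer.Theorems.KatoHalfPinch

end
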